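import Mathlib
import HarnessLib

/-!
# Crux `FemtoCurvatureTwoPoint` (stmt-QuantumFields-9363, route `LangevinControlUV`):
# the rate-free encoding, I — abstract real-analysis lemmas

Support file of the line `generic-step-gamma-encoding` (lead c3, `--supports stmt-QuantumFields-9363`;
registered names `piece_spec`, `exists_delta_le_two_mul_family`). Part I of three (`…RateFreeAux` ⊂ `…RateFreeEncoding` ⊂
`…RateFree`): the measure-free ingredients of the refined generic-step encoding —
a factor-`2` modulus for finite families of positive continuous
functions on a compact interval (`exists_delta_le_two_mul_family`, uniform continuity), the arithmetic of
cutting a coupling block into equal pieces (`piece_spec`), the step values coded by `Nat.pair`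
(`stepVal_pos`, `stepVal_le`, `le_of_femto`; their genericity is lead c2's landed `GenericStepGammaEncoding.exists_generic`)
and the torus-distance bookkeeping (`dist_eq_sqrt_nat`).
See `…RateFreeEncoding` for the construction that uses them and `…RateFree` for the crux-level statement.
-/

set_option autoImplicit false

noncomputable section

open Filter Topology MeasureTheory

namespace Summit.QuantumFields.YangMills.Theorems.FemtoCurvatureTwoPoint.RateFree

/-! ## §2 Fine partitions: positive continuous functions vary by at most a factor `2` on short pieces -/

/-- One positive continuous function on a compact interval: a modulus `δ > 0` below which it varies by
at most a factor `2` (minimum `m > 0` on the compact set, uniform continuity at precision `m/2`). [folklore] -/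
theorem exists_delta_le_two_mul {f : ℝ → ℝ} {A B : ℝ} (hf : ContinuousOn f (Set.Icc A B))
    (hpos : ∀ β ∈ Set.Icc A B, 0 < f β) :
    ∃ δ : ℝ, 0 < δ ∧ ∀ β ∈ Set.Icc A B, ∀ β' ∈ Set.Icc A B, |β - β'| ≤ δ → f β ≤ 2 * f β' := by
  by_cases hAB : A ≤ B
  · obtain ⟨βm, hβm, hmin⟩ := (isCompact_Icc (a := A) (b := B)).exists_isMinOn
      (Set.nonempty_Icc.2 hAB) hf
    set m := f βm with hm_def
    have hm : 0 < m := hpos βm hβm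
    have huc := (isCompact_Icc (a := A) (b := B)).uniformContinuousOn_of_continuous hf
    rw [Metric.uniformContinuousOn_iff] at huc
    obtain ⟨δ, hδ, hδ'⟩ := huc (m / 2) (half_pos hm)
    refine ⟨δ / 2, half_pos hδ, fun β hβ β' hβ' hd => ?_⟩
    have hlt : dist β β' < δ := by
      rw [Real.dist_eq]; linarith
    have h1 := hδ' β hβ β' hβ' hlt
    rw [Real.dist_eq] at h1
    have h2 : m ≤ f β' := (isMinOn_iff.1 hmin) β' hβ'
    have h3 : f β - f β' < m / 2 := (abs_lt.1 h1).2
    linarith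
  · refine ⟨1, one_pos, fun β hβ β' _ _ => ?_⟩
    exact absurd (hβ.1.trans hβ.2) hAB

/-- A finite family of positive continuous functions on a compact interval: ONE modulus `δ > 0` below
which every member varies by at most a factor `2`. [folklore] -/
theorem exists_delta_le_two_mul_family {ι : Type*} [Fintype ι] (F : ι → ℝ → ℝ) {A B : ℝ}
    (hF : ∀ i, ContinuousOn (F i) (Set.Icc A B)) (hpos : ∀ i, ∀ β ∈ Set.Icc A B, 0 < F i β) :
    ∃ δ : ℝ, 0 < δ ∧ ∀ i, ∀ β ∈ Set.Icc A B, ∀ β' ∈ Set.Icc A B, |β - β'| ≤ δ →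
      F i β ≤ 2 * F i β' := by
  classical
  choose d hd hd' using fun i => exists_delta_le_two_mul (hF i) (hpos i)
  by_cases hι : Nonempty ι
  · refine ⟨Finset.univ.inf' (Finset.univ_nonempty_iff.2 hι) d, ?_, fun i β hβ β' hβ' hle => ?_⟩
    · exact (Finset.lt_inf'_iff _).2 fun i _ => hd i
    · exact hd' i β hβ β' hβ' (hle.trans (Finset.inf'_le d (Finset.mem_univ i)))
  · exact ⟨1, one_pos, fun i => absurd ⟨i⟩ hι⟩

/-! ## §3 Piece arithmetic on a block `[A, B)` cut into `N` equal pieces of length `≤ δ` -/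

/-- With `N = ⌈(B - A)/δ⌉₊ + 1` pieces of length `h = (B - A)/N`: `0 < h ≤ δ` (for `A < B`), and a point
`β ∈ [A, B)` lies in piece `j = ⌊(β - A)/h⌋₊ < N`, within `δ` of the piece's left end `A + j h ∈ [A, B)`.
[folklore] -/
theorem piece_spec {A B δ : ℝ} (hAB : A < B) (hδ : 0 < δ) {β : ℝ} (hβA : A ≤ β) (hβB : β < B) :
    let N : ℕ := ⌈(B - A) / δ⌉₊ + 1
    let h : ℝ := (B - A) / N
    let j : ℕ := ⌊(β - A) / h⌋₊
    0 < h ∧ h ≤ δ ∧ j < N ∧ A ≤ A + j * h ∧ A + j * h ≤ β ∧ β < A + (j + 1) * h ∧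
      A + j * h < B ∧ |β - (A + j * h)| ≤ δ := by
  intro N h j
  have hN : (0 : ℝ) < N := by positivity
  have hBA : 0 < B - A := sub_pos.2 hAB
  have hh : 0 < h := div_pos hBA hN
  have hNge : (B - A) / δ ≤ N := by
    have := Nat.le_ceil ((B - A) / δ)
    have h2 : (⌈(B - A) / δ⌉₊ : ℝ) ≤ N := by
      simp only [N]; push_cast; linarith
    exact this.trans h2
  have hhδ : h ≤ δ := by
    simp only [h]
    rw [div_le_iff₀ hN]
    calc B - A = (B - A) / δ * δ := by field_simp
      _ ≤ N * δ := mul_le_mul_of_nonneg_right hNge hδ.le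
      _ = δ * N := mul_comm _ _
  have hq : 0 ≤ (β - A) / h := div_nonneg (sub_nonneg.2 hβA) hh.le
  have hj1 : (j : ℝ) ≤ (β - A) / h := Nat.floor_le hq
  have hj2 : (β - A) / h < j + 1 := Nat.lt_floor_add_one _
  have hjh : (j : ℝ) * h ≤ β - A := by rwa [le_div_iff₀ hh] at hj1
  have hjh2 : β - A < (j + 1) * h := by rwa [div_lt_iff₀ hh] at hj2
  have hjN : j < N := by
    have h1 : (j : ℝ) * h < B - A := lt_of_le_of_lt hjh (by linarith)
    have h2 : (j : ℝ) < (B - A) / h := by rwa [lt_div_iff₀ hh]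
    have h3 : (B - A) / h = N := by
      simp only [h]; field_simp
    rw [h3] at h2
    exact_mod_cast h2
  refine ⟨hh, hhδ, hjN, by nlinarith, by linarith, by linarith, ?_, ?_⟩
  · have : (j : ℝ) * h ≤ ((N : ℝ) - 1) * h := by
      have hjN' : (j : ℝ) ≤ (N : ℝ) - 1 := by
        have : j + 1 ≤ N := hjN
        have : ((j + 1 : ℕ) : ℝ) ≤ N := by exact_mod_cast this
        push_cast at this; linarith
      exact mul_le_mul_of_nonneg_right hjN' hh.le
    have hNh : (N : ℝ) * h = B - A := by simp only [h]; field_simp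
    nlinarith
  · rw [abs_le]; constructor <;> nlinarith

/-! ## §4 Step values coded by `Nat.pair` -/

/-- The step value of piece code `p`: `α_p = (1 + t 2^{-p}) / (M_p + 1)`, `M_p = (Nat.unpair p).1`. -/
theorem stepVal_pos {t : ℝ} (ht : 0 ≤ t) (p : ℕ) :
    0 < (((Nat.unpair p).1 : ℝ) + 1)⁻¹ * (1 + t * ((2 : ℝ) ^ p)⁻¹) := by positivity

/-- `α_p ≤ 2 / (M_p + 1)` for `t ≤ 1`. -/
theorem stepVal_le {t : ℝ} (ht1 : t ≤ 1) (p : ℕ) :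
    (((Nat.unpair p).1 : ℝ) + 1)⁻¹ * (1 + t * ((2 : ℝ) ^ p)⁻¹) ≤ 2 / (((Nat.unpair p).1 : ℝ) + 1) := by
  have hx : ((2 : ℝ) ^ p)⁻¹ ≤ 1 := inv_le_one_of_one_le₀ (one_le_pow₀ (by norm_num))
  have hx0 : (0 : ℝ) ≤ ((2 : ℝ) ^ p)⁻¹ := by positivity
  have h1 : 1 + t * ((2 : ℝ) ^ p)⁻¹ ≤ 2 := by nlinarith [mul_le_mul ht1 hx hx0 zero_le_one]
  have hpos : (0 : ℝ) < (((Nat.unpair p).1 : ℝ) + 1)⁻¹ := by positivity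
  calc (((Nat.unpair p).1 : ℝ) + 1)⁻¹ * (1 + t * ((2 : ℝ) ^ p)⁻¹)
        ≤ (((Nat.unpair p).1 : ℝ) + 1)⁻¹ * 2 := mul_le_mul_of_nonneg_left h1 hpos.le
    _ = 2 / (((Nat.unpair p).1 : ℝ) + 1) := by rw [mul_comm, div_eq_mul_inv]

/-- **Femto ⇒ validated**: `L · α_p ≤ 1` forces `L ≤ M_p` (because `α_p > 1/(M_p + 1)` for `t > 0`). -/
theorem le_of_femto {t : ℝ} (ht : 0 < t) {p L : ℕ}
    (hL : (L : ℝ) * ((((Nat.unpair p).1 : ℝ) + 1)⁻¹ * (1 + t * ((2 : ℝ) ^ p)⁻¹)) ≤ 1) :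
    L ≤ (Nat.unpair p).1 := by
  by_contra hlt
  have hle : ((Nat.unpair p).1 : ℝ) + 1 ≤ L := by
    exact_mod_cast Nat.lt_iff_add_one_le.1 (not_le.1 hlt)
  have hpos : (0 : ℝ) < ((Nat.unpair p).1 : ℝ) + 1 := by positivity
  have hx : (0 : ℝ) < t * ((2 : ℝ) ^ p)⁻¹ := by positivity
  have h1 : (L : ℝ) * ((((Nat.unpair p).1 : ℝ) + 1)⁻¹ * (1 + t * ((2 : ℝ) ^ p)⁻¹)) =
      (L : ℝ) * (1 + t * ((2 : ℝ) ^ p)⁻¹) / (((Nat.unpair p).1 : ℝ) + 1) := by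
    rw [div_eq_mul_inv]; ring
  rw [h1, div_le_one hpos] at hL
  nlinarith [mul_pos (hpos.trans_le hle) hx]

/-! ## §5 Torus-distance bookkeeping -/

/-- Torus distances between distinct sites are square roots of positive integers. [folklore] -/
theorem dist_eq_sqrt_nat {L : ℕ} (x y : Fin 4 → ZMod L) (hxy : x ≠ y) :
    ∃ m : ℕ, 1 ≤ m ∧
      Real.sqrt (∑ k : Fin 4, (((x k - y k).valMinAbs : ℤ) : ℝ) ^ 2) = Real.sqrt (m : ℝ) := by
  refine ⟨∑ k : Fin 4, ((x k - y k).valMinAbs.natAbs) ^ 2, ?_, ?_⟩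
  · obtain ⟨k, hk⟩ := Function.ne_iff.1 hxy
    have hne : (x k - y k).valMinAbs ≠ 0 := by
      rw [Ne, ZMod.valMinAbs_eq_zero, sub_eq_zero]; exact hk
    have h1 : 1 ≤ (x k - y k).valMinAbs.natAbs ^ 2 := by
      have : 1 ≤ (x k - y k).valMinAbs.natAbs := Nat.one_le_iff_ne_zero.2 (Int.natAbs_ne_zero.2 hne)
      nlinarith
    exact h1.trans (Finset.single_le_sum (f := fun i => ((x i - y i).valMinAbs.natAbs) ^ 2)
      (fun i _ => Nat.zero_le _) (Finset.mem_univ k))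
  · congr 1
    push_cast
    refine Finset.sum_congr rfl fun k _ => ?_
    rw [Nat.cast_natAbs, Int.cast_abs, sq_abs]

end Summit.QuantumFields.YangMills.Theorems.FemtoCurvatureTwoPoint.RateFree

end
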